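import Literature.Computability.ImplicitComplexity.SoftTypeAssignmentSubstMpxA
import HarnessLib

/-!
# The substitution lemma of `STA₊`, V: contracting the copies (rule `(m)`, merge)

Continuation of `SoftTypeAssignmentSubstMpxA.lean` (GR07/GMR08 Substitution Lemma, case `(m)`).
After the `|S|` renamed copies of the substituend `N` of the contracted-into slot have been
substituted into the premise (by the induction hypothesis, on the family `Family.copies`), the
copies of each free variable `t` of `N` are contracted back into `t` by one multiplexor of rank
`|S| ≤ r` per variable (GR07: "followed by a suitable sequence of `(m)` rules"). This file performs
that finite iteration and identifies its end result with the conclusion of the substitution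
goal for the original family:

* `STA.cpMergeRen`, `STA.cpMergeCtx` — the renaming / context after contracting the copies of the
  variables in a finite set `T'`; one more multiplexor extends `T'` by one variable
  (`cpMergeRen_insert`, `cpMergeCtx_insert`);
* `MpxData.merge` — the iteration; `MpxData.cpMergeCtx_final`, `MpxData.cpMergeRen_final` — after
  all variables of `N` the context is `resCtx` and the term is `P[famSubst]`;
* `MpxData.solve` — the `(m)` case of the substitution goal when the contracted-into slot is
  substituted.

## References

* [GaboardiRonchiDellaRocca2007] GR07, Substitution Lemma, case `(m)`.
-/

namespace Literature.Computability.ImplicitComplexity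

namespace STA

open Finset

/-! ### Contracting the copies of finitely many variables -/

/-- The renaming after contracting, for each `t ∈ T'`, the copy slots `L + ⟨s, t⟩ (s ∈ S)` into
`t`. [folklore] -/
def cpMergeRen (L : ℕ) (S T' : Finset ℕ) : ℕ → ℕ := fun m =>
  if L ≤ m ∧ (Nat.unpair (m - L)).1 ∈ S ∧ (Nat.unpair (m - L)).2 ∈ T' then (Nat.unpair (m - L)).2 else m

/-- The context after contracting the copies of the variables in `T'`: the copy slots are gone,
the slots `t ∈ T'` carry the levelled assumption, the rest is unchanged. [folklore] -/
def cpMergeCtx (L : ℕ) (S T' : Finset ℕ) (R₀ Δ : Ctx) (c ℓ : ℕ → ℕ) : Ctx := fun m =>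
  if L ≤ m ∧ (Nat.unpair (m - L)).1 ∈ S ∧ (Nat.unpair (m - L)).2 ∈ T' then none
  else if m ∈ T' then Δ.levelled c ℓ m else R₀ m

/-- Nothing contracted yet: identity renaming. [folklore] -/
theorem cpMergeRen_empty (L : ℕ) (S : Finset ℕ) : cpMergeRen L S ∅ = id := by
  funext m
  simp [cpMergeRen]

/-- Nothing contracted yet: the context is unchanged. [folklore] -/
theorem cpMergeCtx_empty (L : ℕ) (S : Finset ℕ) (R₀ Δ : Ctx) (c ℓ : ℕ → ℕ) : cpMergeCtx L S ∅ R₀ Δ c ℓ = R₀ := by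
  funext m
  simp [cpMergeCtx]

/-- Membership in the set of copy slots of `t₀`. [folklore] -/
theorem mem_copySlots_iff {L : ℕ} {S : Finset ℕ} {t₀ m : ℕ} :
    m ∈ S.image (fun s => copyRen L s t₀) ↔ L ≤ m ∧ (Nat.unpair (m - L)).1 ∈ S ∧ (Nat.unpair (m - L)).2 = t₀ := by
  constructor
  · intro h
    obtain ⟨s, hs, rfl⟩ := mem_image.1 h
    exact ⟨le_copyRen _ _ _, by simp [hs], by simp⟩
  · rintro ⟨h1, h2, h3⟩
    refine mem_image.2 ⟨(Nat.unpair (m - L)).1, h2, ?_⟩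
    conv_rhs => rw [eq_copyRen_of_le h1]
    rw [h3]

/-- One more multiplexor contracts the copies of one more variable (renamings). [folklore] -/
theorem cpMergeRen_insert {L : ℕ} {S T' : Finset ℕ} {t₀ : ℕ} (ht₀ : t₀ ∉ T')
    (hT' : ∀ t ∈ T', t < L) :
    mpxRen (S.image fun s => copyRen L s t₀) t₀ ∘ cpMergeRen L S T' = cpMergeRen L S (insert t₀ T') := by
  funext m
  simp only [Function.comp_apply, cpMergeRen]
  by_cases hA : L ≤ m ∧ (Nat.unpair (m - L)).1 ∈ S
  · by_cases hB : (Nat.unpair (m - L)).2 ∈ T'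
    · have h1 : (Nat.unpair (m - L)).2 ∉ S.image fun s => copyRen L s t₀ := fun h =>
        absurd (mem_copySlots_iff.1 h).1 (not_le.2 (hT' _ hB))
      simp [hA, hB, mpxRen_of_not_mem h1]
    · by_cases hC : (Nat.unpair (m - L)).2 = t₀
      · have h1 : m ∈ S.image fun s => copyRen L s t₀ := mem_copySlots_iff.2 ⟨hA.1, hA.2, hC⟩
        simp [hA, hC, ht₀, mpxRen_of_mem h1]
      · have h1 : m ∉ S.image fun s => copyRen L s t₀ := fun h => hC (mem_copySlots_iff.1 h).2.2
        simp [hA, hB, hC, mpxRen_of_not_mem h1]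
  · have h1 : m ∉ S.image fun s => copyRen L s t₀ := fun h =>
      hA ⟨(mem_copySlots_iff.1 h).1, (mem_copySlots_iff.1 h).2.1⟩
    have h2 : ¬(L ≤ m ∧ (Nat.unpair (m - L)).1 ∈ S ∧ (Nat.unpair (m - L)).2 ∈ T') := fun h => hA ⟨h.1, h.2.1⟩
    have h3 : ¬(L ≤ m ∧ (Nat.unpair (m - L)).1 ∈ S ∧ (Nat.unpair (m - L)).2 ∈ insert t₀ T') :=
      fun h => hA ⟨h.1, h.2.1⟩
    rw [if_neg h2, if_neg h3, mpxRen_of_not_mem h1]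

/-- One more multiplexor contracts the copies of one more variable (contexts). [folklore] -/
theorem cpMergeCtx_insert {L : ℕ} {S T' : Finset ℕ} {t₀ : ℕ} (ht₀ : t₀ ∉ T') (ht₀L : t₀ < L)
    (R₀ Δ : Ctx) (c ℓ : ℕ → ℕ) (σ₀ : SoftTy) (hσ₀ : Δ.levelled c ℓ t₀ = some σ₀.bang) :
    (cpMergeCtx L S T' R₀ Δ c ℓ).mpx (S.image fun s => copyRen L s t₀) t₀ σ₀ =
      cpMergeCtx L S (insert t₀ T') R₀ Δ c ℓ := by
  funext m
  by_cases hC : m ∈ S.image fun s => copyRen L s t₀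
  · obtain ⟨h1, h2, h3⟩ := mem_copySlots_iff.1 hC
    rw [Ctx.mpx_of_mem _ _ hC]
    simp [cpMergeCtx, h1, h2, h3]
  · by_cases hm : m = t₀
    · subst hm
      rw [Ctx.mpx_self _ _ hC]
      have : ¬(L ≤ m ∧ (Nat.unpair (m - L)).1 ∈ S ∧ (Nat.unpair (m - L)).2 ∈ insert m T') :=
        fun h => absurd h.1 (not_le.2 ht₀L)
      rw [cpMergeCtx, if_neg this, if_pos (mem_insert_self _ _), hσ₀]
    · rw [Ctx.mpx_of_ne _ _ hC hm]
      simp only [cpMergeCtx, mem_insert, hm, false_or]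
      have : (L ≤ m ∧ (Nat.unpair (m - L)).1 ∈ S ∧ ((Nat.unpair (m - L)).2 = t₀ ∨ (Nat.unpair (m - L)).2 ∈ T')) ↔
          (L ≤ m ∧ (Nat.unpair (m - L)).1 ∈ S ∧ (Nat.unpair (m - L)).2 ∈ T') := by
        constructor
        · rintro ⟨h1, h2, h3 | h3⟩
          · exact absurd (mem_copySlots_iff.2 ⟨h1, h2, h3⟩) hC
          · exact ⟨h1, h2, h3⟩
        · rintro ⟨h1, h2, h3⟩
          exact ⟨h1, h2, Or.inr h3⟩
      rw [if_congr this rfl rfl]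

namespace MpxData

variable {r : ℕ} {Θ₀ : Ctx} {S : Finset ℕ} {j : ℕ} {σ : SoftTy} {X : Finset ℕ} {N : ℕ → Term}
  {Δ : Ctx} {c ℓ wt e : ℕ → ℕ} {K : ℕ}

/-- Free variables of `N j` lie in `[K, 2K)`. [folklore] -/
theorem fv_j_bounds (D : MpxData r Θ₀ S j σ X N Δ c ℓ wt e K) {t : ℕ} (ht : t ∈ (N j).fv) :
    K ≤ t ∧ t < 2 * K := by
  have h := ((D.mem_fv_j_iff t).1 ht).1
  exact ⟨D.hΔlo t h, D.hΔhi t h⟩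

/-- The result context of the copies' family at a copy slot. [folklore] -/
theorem resCtx_copy (D : MpxData r Θ₀ S j σ X N Δ c ℓ wt e K) {s t : ℕ} (hs : s ∈ S) (hΔt : c t = j) :
    resCtx Θ₀ (cpX X S j) (cpΔ (2 * K) S j Δ c) (cpc (2 * K) c) (cpℓ S j ℓ) (copyRen (2 * K) s t) =
      (Δ t).map fun τ => ⟨τ.bangs + (ℓ j - 1), τ.lin⟩ := by
  have hL : ¬ copyRen (2 * K) s t < 2 * K := not_lt.2 (le_copyRen _ _ _)
  have h1 : copyRen (2 * K) s t ∉ cpX X S j := fun h => by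
    rcases mem_union.1 h with h | h
    · exact hL ((D.hXK (mem_of_mem_erase h)).trans_le (by omega))
    · exact hL ((D.hSK h).trans_le (by omega))
  have h2 : Θ₀ (copyRen (2 * K) s t) = none := by
    by_contra hne
    exact hL ((D.hKΘ _ hne).trans_le (by omega))
  rw [resCtx_apply, if_neg h1, h2, Option.none_or, Ctx.levelled_apply]
  simp [cpΔ, cpc, cpℓ, hL, hs, hΔt]

/-- The result context of the copies' family at a slot of the block `[K, 2K)` owned by `j`.
[folklore] -/
theorem resCtx_owned_j (D : MpxData r Θ₀ S j σ X N Δ c ℓ wt e K) {t : ℕ} (ht : t ∈ (N j).fv) :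
    resCtx Θ₀ (cpX X S j) (cpΔ (2 * K) S j Δ c) (cpc (2 * K) c) (cpℓ S j ℓ) t = none := by
  obtain ⟨hKt, ht2⟩ := D.fv_j_bounds ht
  have hct : c t = j := ((D.mem_fv_j_iff t).1 ht).2
  have h1 : t ∉ cpX X S j := fun h => by
    rcases mem_union.1 h with h | h
    · exact not_lt.2 hKt (D.hXK (mem_of_mem_erase h))
    · exact not_lt.2 hKt (D.hSK h)
  have h2 : Θ₀ t = none := by
    by_contra hne
    exact not_lt.2 hKt (D.hKΘ _ hne)
  rw [resCtx_apply, if_neg h1, h2, Option.none_or, Ctx.levelled_apply]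
  simp [cpΔ, ht2, hct]

/-- **The iteration**: after contracting the copies of the variables in `T' ⊆ FV(N j)` the
substituted premise is typed in `cpMergeCtx` with subject renamed by `cpMergeRen`, with unchanged
measures. [cite: GaboardiRonchiDellaRocca2007, Substitution Lemma (case (m))] -/
theorem merge (D : MpxData r Θ₀ S j σ X N Δ c ℓ wt e K) (hcard : S.card ≤ r) {w' d' : ℕ} {Q : Term} {μ : SoftTy}
    (hQ : WTyping r w' d' (resCtx Θ₀ (cpX X S j) (cpΔ (2 * K) S j Δ c) (cpc (2 * K) c) (cpℓ S j ℓ)) Q μ) :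
    ∀ T' : Finset ℕ, T' ⊆ (N j).fv →
      WTyping r w' d' (cpMergeCtx (2 * K) S T' (resCtx Θ₀ (cpX X S j) (cpΔ (2 * K) S j Δ c) (cpc (2 * K) c) (cpℓ S j ℓ)) Δ c ℓ)
        (Q.rename (cpMergeRen (2 * K) S T')) μ := by
  intro T'
  induction T' using Finset.induction_on with
  | empty =>
    intro _
    rw [cpMergeCtx_empty, cpMergeRen_empty, Term.rename_id]
    exact hQ
  | @insert t₀ T' ht₀ IH =>
    intro hsub
    have hT' : T' ⊆ (N j).fv := (subset_insert _ _).trans hsub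
    have ht₀fv : t₀ ∈ (N j).fv := hsub (mem_insert_self _ _)
    obtain ⟨hKt₀, ht₀2⟩ := D.fv_j_bounds ht₀fv
    obtain ⟨hΔt₀, hct₀⟩ := (D.mem_fv_j_iff t₀).1 ht₀fv
    obtain ⟨τ₀, hτ₀⟩ := Option.ne_none_iff_exists'.1 hΔt₀
    obtain ⟨_, _, hℓj, _⟩ := D.sigma_eq
    have hT'L : ∀ t ∈ T', t < 2 * K := fun t ht => (D.fv_j_bounds (hT' ht)).2
    have hprev := IH hT'
    refine WTyping.mpx (σ := ⟨τ₀.bangs + (ℓ j - 1), τ₀.lin⟩) (S.image fun s => copyRen (2 * K) s t₀) t₀ hprev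
      ?_ ?_ (card_image_le.trans hcard) ?_ ?_
    · intro m hm
      obtain ⟨s, hs, rfl⟩ := mem_image.1 hm
      have hL : ¬ copyRen (2 * K) s t₀ < 2 * K := not_lt.2 (le_copyRen _ _ _)
      have h1 : ¬(2 * K ≤ copyRen (2 * K) s t₀ ∧ (Nat.unpair (copyRen (2 * K) s t₀ - 2 * K)).1 ∈ S ∧
          (Nat.unpair (copyRen (2 * K) s t₀ - 2 * K)).2 ∈ T') := by
        simp [ht₀]
      have h2 : copyRen (2 * K) s t₀ ∉ T' := fun h => hL (hT'L _ h)
      rw [cpMergeCtx, if_neg h1, if_neg h2, D.resCtx_copy hs hct₀, hτ₀]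
      rfl
    · have h1 : ¬(2 * K ≤ t₀ ∧ (Nat.unpair (t₀ - 2 * K)).1 ∈ S ∧ (Nat.unpair (t₀ - 2 * K)).2 ∈ T') :=
        fun h => absurd h.1 (not_le.2 ht₀2)
      rw [cpMergeCtx, if_neg h1, if_neg ht₀]
      exact D.resCtx_owned_j ht₀fv
    · refine (cpMergeCtx_insert ht₀ ht₀2 _ _ _ _ _ ?_).symm
      simp only [Ctx.levelled_apply, hτ₀, Option.map_some, SoftTy.bang, hct₀, Option.some.injEq,
        SoftTy.mk.injEq, and_true]
      omega
    · rw [Term.rename_rename, cpMergeRen_insert ht₀ hT'L]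

/-- After contracting the copies of ALL free variables of `N j`, the context is the result context
of the original family. [folklore] -/
theorem cpMergeCtx_final (D : MpxData r Θ₀ S j σ X N Δ c ℓ wt e K) :
    cpMergeCtx (2 * K) S (N j).fv (resCtx Θ₀ (cpX X S j) (cpΔ (2 * K) S j Δ c) (cpc (2 * K) c) (cpℓ S j ℓ)) Δ c ℓ =
      resCtx (Θ₀.mpx S j σ) X Δ c ℓ := by
  funext m
  simp only [cpMergeCtx]
  by_cases h1 : 2 * K ≤ m ∧ (Nat.unpair (m - 2 * K)).1 ∈ S ∧ (Nat.unpair (m - 2 * K)).2 ∈ (N j).fv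
  · -- a copy slot: absent from the target
    rw [if_pos h1, resCtx_apply]
    have hmX : m ∉ X := fun h => by have := D.hXK h; omega
    have hmS : m ∉ S := fun h => by have := D.hSK h; omega
    have hmj : m ≠ j := fun h => by have := D.hKj; omega
    have hΘ : Θ₀ m = none := by
      by_contra hne; have := D.hKΘ m hne; omega
    have hΔ : Δ m = none := by
      by_contra hne; have := D.hΔhi m hne; omega
    rw [if_neg hmX, Ctx.mpx_of_ne Θ₀ σ hmS hmj, hΘ, Option.none_or, Ctx.levelled_apply, hΔ]
    rfl
  · rw [if_neg h1]
    by_cases h2 : m ∈ (N j).fv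
    · -- a variable of `N j`: it carries its levelled assumption
      rw [if_pos h2, resCtx_apply]
      obtain ⟨hKm, _⟩ := D.fv_j_bounds h2
      have hmX : m ∉ X := fun h => not_lt.2 hKm (D.hXK h)
      have hmS : m ∉ S := fun h => not_lt.2 hKm (D.hSK h)
      have hmj : m ≠ j := fun h => not_lt.2 hKm (h ▸ D.hKj)
      have hΘ : Θ₀ m = none := by
        by_contra hne; exact not_lt.2 hKm (D.hKΘ m hne)
      rw [if_neg hmX, Ctx.mpx_of_ne Θ₀ σ hmS hmj, hΘ, Option.none_or]
    · rw [if_neg h2, resCtx_apply, resCtx_apply]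
      by_cases h3 : m ∈ S
      · have hm0 : m ∈ cpX X S j := mem_union_right _ h3
        have hΔ : Δ m = none := by
          by_contra hne; exact not_lt.2 (D.hΔlo m hne) (D.hSK h3)
        rw [if_pos hm0, if_neg (D.hSX h3), Ctx.mpx_of_mem Θ₀ σ h3, Option.none_or, Ctx.levelled_apply, hΔ]
        rfl
      · by_cases h4 : m = j
        · subst h4
          have hm0 : m ∉ cpX X S m := fun h => by
            rcases mem_union.1 h with h | h
            · exact (ne_of_mem_erase h) rfl
            · exact h3 h
          have hΔ : Δ m = none := by
            by_contra hne; exact not_lt.2 (D.hΔlo m hne) D.hKj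
          rw [if_neg hm0, if_pos D.hjX, D.hj, Option.none_or, Ctx.levelled_apply]
          simp [cpΔ, show m < 2 * K from by have := D.hKj; omega, hΔ]
        · have hmX0 : m ∈ cpX X S j ↔ m ∈ X := by
            simp [cpX, mem_union, mem_erase, h4, h3]
          rw [Ctx.mpx_of_ne Θ₀ σ h3 h4]
          by_cases h5 : m ∈ X
          · rw [if_pos (hmX0.2 h5), if_pos h5]
          · rw [if_neg (fun h => h5 (hmX0.1 h)), if_neg h5]
            congr 1
            simp only [Ctx.levelled_apply]
            by_cases hmL : m < 2 * K
            · by_cases hcj : c m = j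
              · have hΔ : Δ m = none := by
                  by_contra hne
                  exact h2 ((D.mem_fv_j_iff m).2 ⟨hne, hcj⟩)
                simp [cpΔ, cpc, hmL, hcj, hΔ]
              · cases hΔ : Δ m with
                | none => simp [cpΔ, hmL, hcj, hΔ]
                | some τ =>
                  have hcX : c m ∈ X := D.F.owned m (by simp [hΔ])
                  have hcS : c m ∉ S := fun h => D.hSX h hcX
                  simp [cpΔ, cpc, cpℓ, hmL, hcj, hΔ, hcS]
            · have hΔ : Δ m = none := by
                by_contra hne; exact hmL (D.hΔhi m hne)
              have : cpΔ (2 * K) S j Δ c m = none := by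
                simp only [cpΔ, hmL, if_false]
                by_cases h6 : (Nat.unpair (m - 2 * K)).1 ∈ S ∧ c (Nat.unpair (m - 2 * K)).2 = j
                · rw [if_pos h6]
                  by_contra hne
                  exact h1 ⟨not_lt.1 hmL, h6.1, (D.mem_fv_j_iff _).2 ⟨hne, h6.2⟩⟩
                · rw [if_neg h6]
              simp [this, hΔ]

/-- After contracting the copies of ALL free variables of `N j`, the subject is the substituted
conclusion subject. [folklore] -/
theorem cpMergeRen_final (D : MpxData r Θ₀ S j σ X N Δ c ℓ wt e K) {w d : ℕ} {P₀ : Term} {μ : SoftTy}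
    (E₀ : WTyping r w d Θ₀ P₀ μ) :
    (P₀.substp (famSubst (cpX X S j) (cpN (2 * K) S j N))).rename (cpMergeRen (2 * K) S (N j).fv) =
      (P₀.rename (mpxRen S j)).substp (famSubst X N) := by
  rw [Term.rename_substp, Term.substp_rename]
  refine Term.substp_congr_fv fun i hi => ?_
  have hΘi : Θ₀ i ≠ none := E₀.ne_none_of_mem_fv hi
  have hiK : i < K := D.hKΘ i hΘi
  have hij : i ≠ j := fun h => hΘi (h ▸ D.hj)
  simp only [Function.comp_apply]
  by_cases hiS : i ∈ S
  · -- a contracted slot: its copy of `N j` folds back onto `N j`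
    have hi0 : i ∈ cpX X S j := mem_union_right _ hiS
    rw [famSubst_of_mem _ hi0, mpxRen_of_mem hiS, famSubst_of_mem _ D.hjX]
    simp only [cpN, hiS, if_true, Term.rename_rename]
    refine Term.rename_id_of_fv fun t ht => ?_
    simp [Function.comp_apply, cpMergeRen, le_copyRen, hiS, ht]
  · rw [mpxRen_of_not_mem hiS]
    by_cases hiX : i ∈ X
    · have hi0 : i ∈ cpX X S j := mem_union_left _ (mem_erase.2 ⟨hij, hiX⟩)
      rw [famSubst_of_mem _ hi0, famSubst_of_mem _ hiX]
      simp only [cpN, hiS, if_false]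
      refine Term.rename_id_of_fv fun t ht => ?_
      obtain ⟨B, _, hD⟩ := D.F.deriv i hiX
      have h1 : (Δ.part c i) t ≠ none := hD.ne_none_of_mem_fv ht
      have h2 : Δ t ≠ none := by
        simp only [Ctx.part_apply] at h1
        by_cases h : c t = i
        · simpa [h] using h1
        · simp [h] at h1
      have := D.hΔhi t h2
      have h3 : ¬(2 * K ≤ t) := by omega
      simp [cpMergeRen, h3]
    · have hi0 : i ∉ cpX X S j := fun h => by
        rcases mem_union.1 h with h | h
        · exact hiX (mem_of_mem_erase h)
        · exact hiS h
      rw [famSubst_of_not_mem _ hi0, famSubst_of_not_mem _ hiX]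
      have h3 : ¬(2 * K ≤ i) := by omega
      simp [Term.rename, cpMergeRen, h3]

/-- **The `(m)` case of the substitution goal, contracted-into slot substituted** (after the
substituends have been moved to fresh slots): substitute the copies into the premise and contract
their variables. [cite: GaboardiRonchiDellaRocca2007, Substitution Lemma (case (m))] -/
theorem solve (D : MpxData r Θ₀ S j σ X N Δ c ℓ wt e K) {w d : ℕ} {P₀ : Term} {μ : SoftTy}
    (E₀ : WTyping r w d Θ₀ P₀ μ) (hcard : S.card ≤ r) (IH : SubstGoal r w d Θ₀ P₀ μ) :
    ∃ w' d', w' ≤ w + famCost r X ℓ wt ∧ d' ≤ max d (famDeg X ℓ e) ∧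
      WTyping r w' d' (resCtx (Θ₀.mpx S j σ) X Δ c ℓ) ((P₀.rename (mpxRen S j)).substp (famSubst X N)) μ := by
  obtain ⟨w', d', hw', hd', hQ⟩ := IH D.copies
  refine ⟨w', d', hw'.trans (Nat.add_le_add_left (D.famCost_copies_le hcard) _),
    hd'.trans (max_le_max le_rfl D.famDeg_copies_le), ?_⟩
  have := D.merge hcard hQ (N j).fv subset_rfl
  rwa [D.cpMergeCtx_final, D.cpMergeRen_final E₀] at this

end MpxData

end STA

end Literature.Computability.ImplicitComplexity
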